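import Literature.Algebra.Homology.GroupCohomologyFiniteIndexFiniteness
import HarnessLib

/-!
# Finite group cohomology by dimension shifting along a coresolution

Topic `Algebra/Homology`; namespace `Literature.Algebra.Homology`.  Theorems only (no definition,
no named fact, no instance, no `sorry`).

Let `G` be a group and `Z 0 → W 0 → W 1 → ⋯` a CORESOLUTION of the `k`-linear representation
`Z 0` of `G`, presented by its short exact pieces `0 → Z a → W a → Z (a+1) → 0` (`a ≥ 0`).  If
every `Hᵇ(G, W a)` is finite, then every `Hᵇ(G, Z a)` is finite, in particular
**`Hᵇ(G, Z 0)` is finite for all `b`** (`finite_groupCohomology_of_coresolution`,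
`finite_groupCohomology_of_coresolution_zero`).  Proof: induction on `b` simultaneously for all
`a` — `H⁰(G, Z a) ↪ H⁰(G, W a)` (left exactness of invariants), and the exact segment
`Hᵇ(G, Z (a+1)) → Hᵇ⁺¹(G, Z a) → Hᵇ⁺¹(G, W a)` of the long exact sequence (Mathlib
`groupCohomology.mapShortComplex₁_exact`; tree `finite_groupCohomology_succ_of_shortExact`).
This is the spectral-sequence-free form of the finiteness half of Brown's criterion
([Brown1982CohomologyGroups, VII (7.10) p. 174, the spectral sequence of a `G`-complex
`E₁^{pq} = Π_{σ ∈ Σ_p} H^q(G_σ, M) ⇒ H^{p+q}(G, M)` for `X` acyclic; VIII §2, dimension shifting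
III §7]): applied to the coresolution `0 → M → Fun(X₀, M) → Fun(X₁, M) → ⋯` of an acyclic
`G`-complex with finitely many cells modulo `G`, finiteness of the `E₁`-terms gives finiteness of
the abutment.  The coresolution may be infinite; no boundedness is needed.

Also: `finite_groupCohomology_zero_of_shortExact` (degree `0`).

## References

* K. S. Brown, *Cohomology of Groups*, GTM 87 (1982), III §7 (dimension shifting), VII §7
  (equivariant cohomology, (7.10)), VIII §2 [Brown1982CohomologyGroups].
-/

noncomputable section

namespace Literature.Algebra.Homology

open CategoryTheory groupCohomology

universe u

variable {k G : Type u} [CommRing k] [Group G]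

/-- **Degree `0`**: for a short exact sequence `0 → X₁ → X₂ → X₃ → 0` of representations,
`H⁰(G, X₁) ↪ H⁰(G, X₂)` (Mathlib `groupCohomology.mono_map_0_of_mono`), so `H⁰(G, X₁)` is finite
when `H⁰(G, X₂)` is. [folklore] -/
theorem finite_groupCohomology_zero_of_shortExact {X : ShortComplex (Rep k G)}
    (hX : X.ShortExact) (h₂ : Finite (groupCohomology X.X₂ 0)) :
    Finite (groupCohomology X.X₁ 0) := by
  haveI := hX.mono_f
  exact Finite.of_injective (map (MonoidHom.id G) X.f 0)
    ((ModuleCat.mono_iff_injective (map (MonoidHom.id G) X.f 0)).1 inferInstance)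

section Coresolution

variable (Z W : ℕ → Rep k G) (ι : ∀ a, Z a ⟶ W a) (π : ∀ a, W a ⟶ Z (a + 1))
  (w : ∀ a, ι a ≫ π a = 0) (hex : ∀ a, (ShortComplex.mk (ι a) (π a) (w a)).ShortExact)

include hex in
/-- **Finiteness propagation along a coresolution.**  Let `Z 0 → W 0 → W 1 → ⋯` be a
coresolution in `Rep k G` presented by short exact pieces `0 → Z a → W a → Z (a+1) → 0`.  If every
`Hᵇ(G, W a)` is finite then every `Hᵇ(G, Z a)` is finite: induction on `b` for all `a` at once,
using `H⁰(G, Z a) ↪ H⁰(G, W a)` and the exact segments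
`Hᵇ(G, Z (a+1)) → Hᵇ⁺¹(G, Z a) → Hᵇ⁺¹(G, W a)`.  (Finiteness half of Brown's criterion, VII (7.10),
by dimension shifting instead of the spectral sequence.)
[cite: Brown1982CohomologyGroups, VII (7.10); III §7] -/
theorem finite_groupCohomology_of_coresolution
    (hW : ∀ a b, Finite (groupCohomology (W a) b)) :
    ∀ b a, Finite (groupCohomology (Z a) b) := by
  intro b
  induction b with
  | zero =>
    intro a
    exact finite_groupCohomology_zero_of_shortExact (hex a) (hW a 0)
  | succ b ih =>
    intro a
    exact finite_groupCohomology_succ_of_shortExact (hex a) b (ih (a + 1)) (hW a (b + 1))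

include hex in
/-- **Corollary (the abutment).**  Under the hypotheses of `finite_groupCohomology_of_coresolution`,
`Hᵇ(G, Z 0)` is finite for every `b`. [cite: Brown1982CohomologyGroups, VII (7.10)] -/
theorem finite_groupCohomology_of_coresolution_zero
    (hW : ∀ a b, Finite (groupCohomology (W a) b)) (b : ℕ) :
    Finite (groupCohomology (Z 0) b) :=
  finite_groupCohomology_of_coresolution Z W ι π w hex hW b 0

end Coresolution

end Literature.Algebra.Homology
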